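import Mathlib
import Summits.ValiantsHypothesis.ValiantsHypothesis.Theses.PrincipalMinorColouring
import Summits.ValiantsHypothesis.ValiantsHypothesis.Theorems.PrincipalMinorColouringPMReprIsDetRepr

/-!
# Crux workfile `Cruxes/TotalRankNotQP/Lines/constants-seam.lean` — the deciding crux `TotalRankNotQP` split along the CONSTANTS seam

(Crux-dir copy of the candidate Theorems file `PrincipalMinorColouringTotalRankNotQPSplit.lean`, same
content under the crux namespace; the Theorems-namespaced original is attached as item evidence for a
prover to land verbatim — planners cannot write `Theorems/`.)

`TotalRankNotQP` (item stmt-ValiantsHypothesis-3775; the minimal total rank `pmc(per_n)` of a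
determinantal expression of `per_n` over `ℂ` is not quasi-polynomially bounded) is equivalent to
the Extended Valiant Hypothesis `VNP_ℂ ⊄ VQP_ℂ` (route DetQP's `DetqpThesis`), hence at least as
strong as the summit.  This file proves the glue of its decomposition into two statements that
are each strictly WEAKER than it (as far as anything in print or in the tree goes) and that live
in different worlds:

* `ConstantFreePerNotQP` — the constant-free Extended Valiant Hypothesis, tolerant of integer
  multipliers: for every sequence of nonzero integers `N_n`, `n ↦ τ(N_n · PER_n)`
  (`Literature.Computability.AlgebraicComplexity.constantFreeComplexity` over `ℤ`: fan-in-two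
  `{+, ×}`-circuits with constants in `{0, 1, -1}`) is not quasi-polynomially bounded.  A
  consequence of `TotalRankNotQP` (a constant-free circuit of size `s` for `N_n · PER_n` gives, by
  homogenisation + VSBR + Valiant's formula-to-determinant construction and one row rescaled by
  `1/N_n`, an affine determinantal representation of `per_n` over `ℂ` of size `s^{O(log n)}`), it
  is the natural target of ARITHMETIC tools unavailable in the presence of arbitrary complex
  constants: Bürgisser's transfer theorem "Shub–Smale τ-conjecture ⇒ `τ(PER_n)` not p-bounded"
  (Comput. Complexity 18 (2009), Main Thm. 1.2) is a THEOREM of the tree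
  (`Literature.Computability.AlgebraicComplexity.not_isPBounded_constantFreeComplexity_perPoly_of_shubSmaleTauConjecture`)
  whose proof is robust both to quasi-polynomial bounds and to a nonzero integer multiplier
  (invert `N_n` modulo an advice prime in Lemma 2.12); likewise the Boolean transfer
  "`τ(N_n · PER_n)` qp-bounded ⇒ `#P ⊆ QP/poly`" needs no GRH.  The multiplier is forced by the
  literature: constant-free completeness of `PER` and every known elimination step hold only up
  to integer factors (Koiran 2004, Thm. 4.3: `2^{p(n)}`; Bhattacharjee–Bläser–Dutta–Mukherjee,
  arXiv:2601.00387 §2.1: "divisions by two occur").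
* `ConstantEliminationQP` — scale-wise elimination of constants for determinantal representations
  of the permanent, up to an integer multiplier: there is an exponent `a` such that an affine
  determinantal representation of `per_n` of size `m` over `ℂ` (arbitrary complex constants)
  yields a nonzero integer `N` and a constant-free circuit for `N · PER_n` over `ℤ` of size
  `≤ 2^((log₂ m + a)^a)` (route: `ℂ`-point ⇒ `ℚ̄`-point of the representation variety by the
  Nullstellensatz; a point over a number field `K` of degree `D` ⇒ restriction of scalars
  `K ↪ ℚ^{D × D}` on Berkowitz's circuit for the determinant ⇒ clearing denominators; the crux is
  the DEGREE `D` of some algebraic point, generically exponential in `m`).  This is the quasi-polynomial, determinantal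
  form of the constant gap "`VP_ℂ ≠ VNP_ℂ ⇒ VP⁰ ≠ VNP⁰` is trivial, but the converse is unclear"
  (Bürgisser 2026, arXiv:2606.25121 §1.2; Koiran 2004; Bürgisser 2000 §4.1 / Thm. 4.5 eliminate
  algebraic constants only modulo primes and under GRH).  It has content exactly at the scales
  `dc_ℂ(per_n) ≤ m < 2^{n^{o(1)}}` and follows from weakly-exponential hardness of `dc_ℂ(per_n)`
  (then it is Ryser/Grenet), so it is consistent with everything believed; it is NOT implied by,
  and does not imply, `TotalRankNotQP` or `VP ≠ VNP`.

Glue (`totalRankNotQP_of_subs`, this file): if `TotalRankNotQP` failed with constant `c`, every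
`n` would carry a principal-minor representation of `per_n(x+J)` of size
`R ≤ 2^((log₂ n + c)^c)`, hence (landed support `PMReprIsDetRepr`) an affine determinantal
representation of `per_n` over `ℂ` of size `R`, hence (`ConstantEliminationQP`) a nonzero integer
`N_n` and a constant-free circuit for `N_n · PER_n` of size
`≤ 2^((log₂ R + a)^a) ≤ 2^((log₂ n + c')^c')` with `c' = (c+2)(a+1)` (`qp_exponent_comp`, the
composition of two quasi-polynomial bounds); choosing such an `N_n` for every `n` (axiom of
choice) gives a nonzero multiplier sequence along which `τ(N_n · PER_n)` is qp-bounded,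
contradicting `ConstantFreePerNotQP`.

References: P. Bürgisser, *Completeness and Reduction in Algebraic Complexity Theory* (2000),
Def. 2.26, §4.1, Thm. 4.5, §8.1; Bürgisser–Clausen–Shokrollahi 1997, (21.41) (extended Valiant
hypothesis); P. Bürgisser, Comput. Complexity 18 (2009) 81–103, Main Thm. 1.2; P. Koiran,
Comput. Complexity 13 (2004) 131–146; P. Bürgisser, arXiv:2606.25121 (2026) §1.2;
Hrubeš–Joglekar, STACS 2025, Thm. 7 (total rank = variable size).
-/

set_option linter.dupNamespace false

open Literature.Computability.AlgebraicComplexity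

namespace Summit.ValiantsHypothesis.ValiantsHypothesis.Cruxes.TotalRankNotQP.ConstantsSeam

/-- **Composition of two quasi-polynomial bounds, at the level of exponents.** If
`t ≤ (L + c)^c` then `(t + a)^a ≤ (L + c')^{c'}` with `c' = (c + 2)(a + 1)`; used with
`L = log₂ n`, `t = log₂ R`: a quantity quasi-polynomial in `R` is quasi-polynomial in `n` when
`R` is. [folklore] -/
theorem qp_exponent_comp (a c L t : ℕ) (ht : t ≤ (L + c) ^ c) :
    (t + a) ^ a ≤ (L + (c + 2) * (a + 1)) ^ ((c + 2) * (a + 1)) := by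
  set c' := (c + 2) * (a + 1) with hc'
  set u := L + c' with hu
  have hc'2 : 2 ≤ c' := by
    have : (c + 2) * (a + 1) ≥ (0 + 2) * (0 + 1) := Nat.mul_le_mul (by omega) (by omega)
    omega
  have hcc' : c ≤ c' := by
    have : (c + 2) * (a + 1) ≥ (c + 2) * 1 := Nat.mul_le_mul_left _ (by omega)
    omega
  have hac' : a ≤ c' := by
    have : (c + 2) * (a + 1) ≥ 1 * (a + 1) := Nat.mul_le_mul_right _ (by omega)
    omega
  have hu2 : 2 ≤ u := le_add_left hc'2
  have hu1 : 1 ≤ u := le_trans (by norm_num) hu2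
  have hLc : L + c ≤ u := Nat.add_le_add_left hcc' L
  have hau : a ≤ u := le_add_left hac'
  have h1 : t + a ≤ u ^ (c + 2) := by
    calc t + a ≤ (L + c) ^ c + a := Nat.add_le_add_right ht a
      _ ≤ u ^ c + u := Nat.add_le_add (Nat.pow_le_pow_left hLc c) hau
      _ ≤ u ^ (c + 1) + u ^ (c + 1) :=
          Nat.add_le_add (Nat.pow_le_pow_right hu1 (Nat.le_succ c))
            (by simpa using Nat.pow_le_pow_right hu1 (show 1 ≤ c + 1 by omega))
      _ = 2 * u ^ (c + 1) := by ring
      _ ≤ u * u ^ (c + 1) := Nat.mul_le_mul_right _ hu2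
      _ = u ^ (c + 2) := by ring
  calc (t + a) ^ a ≤ (u ^ (c + 2)) ^ a := Nat.pow_le_pow_left h1 a
    _ = u ^ ((c + 2) * a) := by rw [← pow_mul]
    _ ≤ u ^ c' := Nat.pow_le_pow_right hu1 (by rw [hc']; exact Nat.mul_le_mul_left _ (Nat.le_succ a))

/-- A size bound `R ≤ 2^B` bounds the binary logarithm: `log₂ R ≤ B`. [folklore] -/
theorem log_two_le_of_le_two_pow {R B : ℕ} (hR : R ≤ 2 ^ B) : Nat.log 2 R ≤ B := by
  calc Nat.log 2 R ≤ Nat.log 2 (2 ^ B) := Nat.log_mono_right hR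
    _ = B := Nat.log_pow (by norm_num) B

/-- **The constants seam of `TotalRankNotQP`** (route PrincipalMinorColouring, deciding crux
stmt-ValiantsHypothesis-3775, split glue `ConstantEliminationQP → ConstantFreePerNotQP → TotalRankNotQP`).
Hypothesis 1 (`ConstantEliminationQP`): scale-wise elimination of constants up to an integer
multiplier — an affine determinantal representation of `per_n` of size `m` over `ℂ` yields a
nonzero integer `N` and a constant-free (`{0, ±1}`-constants, fan-in two) circuit for
`N · PER_n` over `ℤ` of size `≤ 2^((log₂ m + a)^a)`, for one exponent `a` and all `n, m`.
Hypothesis 2 (`ConstantFreePerNotQP`): for every sequence of nonzero integers `N_n`,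
`n ↦ τ(N_n · PER_n)` is not quasi-polynomially bounded (the constant-free Extended Valiant
Hypothesis, multiplier-tolerant form).
Conclusion: `TotalRankNotQP`.  Proof: were every `per_n(x+J)` principal-minor representable in
size `R_n ≤ 2^((log₂ n + c)^c)`, the landed support `PMReprIsDetRepr` would give
`dc_ℂ(per_n) ≤ R_n`, hypothesis 1 would give nonzero `N_n` with
`τ(N_n · PER_n) ≤ 2^((log₂ R_n + a)^a) ≤ 2^((log₂ n + c')^{c'})`, `c' = (c+2)(a+1)`
(`qp_exponent_comp`), and hypothesis 2 applied to the chosen sequence `N` is contradicted.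
[cite: Burgisser2009, Main Thm. 1.2] [cite: Koiran2004, Thm. 4.3] [folklore] -/
theorem totalRankNotQP_of_subs :
    (∃ a : ℕ, ∀ n m : ℕ, Literature.Computability.AlgebraicComplexity.HasDetRepr (Literature.Computability.AlgebraicComplexity.perPoly (Fin n) ℂ) m → ∃ N : ℤ, N ≠ 0 ∧ Literature.Computability.AlgebraicComplexity.constantFreeComplexity (MvPolynomial.C N * Literature.Computability.AlgebraicComplexity.perPoly (Fin n) ℤ) ≤ 2 ^ ((Nat.log 2 m + a) ^ a)) →
    (∀ N : ℕ → ℤ, (∀ n, N n ≠ 0) → ¬ Literature.Computability.AlgebraicComplexity.IsQPBounded (fun n => Literature.Computability.AlgebraicComplexity.constantFreeComplexity (MvPolynomial.C (N n) * Literature.Computability.AlgebraicComplexity.perPoly (Fin n) ℤ))) →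
    Summit.ValiantsHypothesis.ValiantsHypothesis.Theses.PrincipalMinorColouring.TotalRankNotQP := by
  rintro ⟨a, ha⟩ hA
  unfold Summit.ValiantsHypothesis.ValiantsHypothesis.Theses.PrincipalMinorColouring.TotalRankNotQP
  intro c
  by_contra hX
  push Not at hX
  -- `hX : ∀ n, ∃ R ≤ 2 ^ ((log₂ n + c) ^ c), ∃ K κ, per_n(x+J) = n! · det(1 + diag(x∘κ)·K)`
  choose R hR K κ hrepr using hX
  -- each principal-minor representation is an affine determinantal representation of size `R n`
  have hdet : ∀ n, HasDetRepr (perPoly (Fin n) ℂ) (R n) := fun n =>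
    Summit.ValiantsHypothesis.ValiantsHypothesis.Theorems.pmReprIsDetRepr_proof n (R n) (K n) (κ n) (hrepr n)
  -- constant elimination at scale `R n`, with its multiplier `N n ≠ 0`
  choose N hN0 hNτ using fun n => ha n (R n) (hdet n)
  -- the chosen multiplier sequence has qp-bounded `τ(N_n · PER_n)`: contradiction
  refine hA N hN0 ⟨(c + 2) * (a + 1), fun n => ?_⟩
  calc constantFreeComplexity (MvPolynomial.C (N n) * perPoly (Fin n) ℤ)
        ≤ 2 ^ ((Nat.log 2 (R n) + a) ^ a) := hNτ n
    _ ≤ 2 ^ ((Nat.log 2 n + (c + 2) * (a + 1)) ^ ((c + 2) * (a + 1))) :=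
        Nat.pow_le_pow_right (by norm_num)
          (qp_exponent_comp a c (Nat.log 2 n) (Nat.log 2 (R n)) (log_two_le_of_le_two_pow (hR n)))

end Summit.ValiantsHypothesis.ValiantsHypothesis.Cruxes.TotalRankNotQP.ConstantsSeam
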